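import Summits.KontsevichZagierPeriods.KontsevichZagierPeriods.Theses.IsogenyCertificates

/-!
# Sketch — crux `XMapPeriodTransfer` (stmt-KontsevichZagierPeriods-10665), ideator 1 (gen 2)

Card `nash-root` ("divide the x-map covering by its real degree"): first lemmas.

* `slope_identity` (PROVED): on the correspondence `f(x)·G(X) = g(x)·F(X)` between an x-map datum
  `(f, g, c) : P → P'` and a self-datum `(F, G, n) : P' → P'`, the implicit slope satisfies
  `n²·G(X)⁴·P(x)·W(x)² = c²·g(x)⁴·P'(X)·Wₙ(X)²` — i.e. `(dX/dx)² = (c/n)²·P'(X)/P(x)`: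
  every real branch of the correspondence is a rule-2 map with multiplier `c/n`.
* `MulDatum A B n` (statement; `mulDatum_one`, `mulDatum_two`, `mulDatum_three` PROVED by `ring`): Mathlib's division
  polynomials `(Φₙ, ΨSqₙ, n)` form an x-map datum of the crux's own shape from `(A, B)` to itself
  (`[n]^*ω = n·ω`).
* `NashRoot` (the engine, elaborates): every component `C` of `{P > 0}` carries a `ℚ`-semialgebraic
  increasing `C¹` bijection `χ : C → U'` onto the unbounded component of `{P' > 0}` with
  `χ'/√(P'∘χ) = (|c|/m)/√P` for a positive integer `m` (the real degree of the datum on `C`).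
-/

noncomputable section

namespace Summit.KontsevichZagierPeriods.Cruxes.XMapPeriodTransfer.Ideator1G2

open Polynomial Set
open Literature.NumberTheory.Transcendental

/-! ## 1. The slope identity on the correspondence (pure algebra, any field) -/

/-- **Slope identity.** Let `(f, g, c)` satisfy the crux's datum identity towards `P' = X³ + A'X + B'`
and `(F, G, n)` the same identity from `P'` to itself. At any point of the correspondence
`f(x) G(y) = g(x) F(y)` one has `n² G(y)⁴ P(x) W(x)² = c² g(x)⁴ P'(y) Wₙ(y)²`
(`W = f'g − fg'`, `Wₙ = F'G − FG'`). With `R = f/g`, `Rₙ = F/G` this reads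
`(R'(x)/Rₙ'(y))² = (c/n)² · P'(y)/P(x)`: the implicit function `y = χ(x)` of the correspondence has
`|χ'|/√P'(χ) = (|c|/|n|)/√P`. No non-vanishing hypothesis is needed. [folklore] -/
theorem slope_identity {K : Type*} [Field K] {A B A' B' c n : K} {f g F G : K[X]}
    (hd : C (c ^ 2) * g * (f ^ 3 + C A' * f * g ^ 2 + C B' * g ^ 3) =
      (X ^ 3 + C A * X + C B) * (derivative f * g - f * derivative g) ^ 2)
    (hn : C (n ^ 2) * G * (F ^ 3 + C A' * F * G ^ 2 + C B' * G ^ 3) =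
      (X ^ 3 + C A' * X + C B') * (derivative F * G - F * derivative G) ^ 2)
    {x y : K} (hcor : f.eval x * G.eval y = g.eval x * F.eval y) :
    n ^ 2 * G.eval y ^ 4 * (x ^ 3 + A * x + B) * (derivative f * g - f * derivative g).eval x ^ 2 =
      c ^ 2 * g.eval x ^ 4 * (y ^ 3 + A' * y + B') * (derivative F * G - F * derivative G).eval y ^ 2 := by
  have h1 := congrArg (eval x) hd
  have h2 := congrArg (eval y) hn
  simp only [eval_mul, eval_add, eval_pow, eval_C, eval_X] at h1 h2
  set fx := f.eval x
  set gx := g.eval x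
  set Fy := F.eval y
  set Gy := G.eval y
  set Wx := (derivative f * g - f * derivative g).eval x
  set Wy := (derivative F * G - F * derivative G).eval y
  -- homogeneity of the cubic form along the correspondence
  have h3 : (fx ^ 3 + A' * fx * gx ^ 2 + B' * gx ^ 3) * Gy ^ 3 =
      gx ^ 3 * (Fy ^ 3 + A' * Fy * Gy ^ 2 + B' * Gy ^ 3) := by
    linear_combination (fx ^ 2 * Gy ^ 2 + fx * Gy * (gx * Fy) + gx ^ 2 * Fy ^ 2 + A' * gx ^ 2 * Gy ^ 2) * hcor
  linear_combination (-(n ^ 2 * Gy ^ 4)) * h1 + (c ^ 2 * gx ^ 4) * h2 +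
    (n ^ 2 * c ^ 2 * gx * Gy) * h3

/-! ## 2. Multiplication by `n` is a datum of the crux's shape (Mathlib division polynomials) -/

/-- `(Φₙ, ΨSqₙ, n)` — Mathlib's univariate division polynomials of `y² = x³ + Ax + B`, with
`x∘[n] = Φₙ/ΨSqₙ` (Silverman AEC Ex. 3.7(d); tree: `UnivEC.zsmul_P`,
`WeierstrassCurve.Affine.Point.zsmul_some_eq_of_evalEval_ψ_ne_zero`) — satisfy the crux's datum
identity from `(A, B)` to `(A, B)` with `c = n`: the algebraic form of `[n]^*(dx/y) = n·dx/y`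
(AEC III.5.3 Cor.; to be proved for all `n`, e.g. on the tree's universal curve from the translation
invariance of the invariant differential, AEC III.5.1). [cite: SilvermanAEC2009, III.5] -/
def MulDatum (A B : ℚ) (n : ℤ) : Prop :=
  C ((n : ℚ) ^ 2) * (⟨0, 0, 0, A, B⟩ : WeierstrassCurve ℚ).ΨSq n *
      ((⟨0, 0, 0, A, B⟩ : WeierstrassCurve ℚ).Φ n ^ 3 +
        C A * (⟨0, 0, 0, A, B⟩ : WeierstrassCurve ℚ).Φ n * (⟨0, 0, 0, A, B⟩ : WeierstrassCurve ℚ).ΨSq n ^ 2 +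
        C B * (⟨0, 0, 0, A, B⟩ : WeierstrassCurve ℚ).ΨSq n ^ 3) =
    (X ^ 3 + C A * X + C B) *
      (derivative ((⟨0, 0, 0, A, B⟩ : WeierstrassCurve ℚ).Φ n) * (⟨0, 0, 0, A, B⟩ : WeierstrassCurve ℚ).ΨSq n -
        (⟨0, 0, 0, A, B⟩ : WeierstrassCurve ℚ).Φ n * derivative ((⟨0, 0, 0, A, B⟩ : WeierstrassCurve ℚ).ΨSq n)) ^ 2

/-- `n = 1`: the identity datum `(X, 1, 1)`. [folklore] -/
theorem mulDatum_one (A B : ℚ) : MulDatum A B 1 := by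
  simp only [MulDatum, WeierstrassCurve.Φ_one, WeierstrassCurve.ΨSq_one]
  simp

/-- `n = 2`: the duplication datum `(X⁴ − 2AX² − 8BX + A², 4(X³ + AX + B), 2)` (card
duplication-saturation's `dup_isDatum`, here read off Mathlib's `Φ₂`, `Ψ₂Sq`). [folklore] -/
theorem mulDatum_two (A B : ℚ) : MulDatum A B 2 := by
  simp only [MulDatum, WeierstrassCurve.Φ_two, WeierstrassCurve.ΨSq_two, WeierstrassCurve.Ψ₂Sq,
    WeierstrassCurve.b₂, WeierstrassCurve.b₄, WeierstrassCurve.b₆, WeierstrassCurve.b₈]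
  refine Polynomial.funext fun t => ?_
  simp only [map_sub, map_add, derivative_mul, derivative_X_pow, derivative_C, derivative_X,
    eval_sub, eval_add, eval_mul, eval_pow, eval_C, eval_X, eval_natCast, eval_ofNat, map_natCast]
  norm_num
  ring1

/-- `n = 3`: `(Φ₃, Ψ₃², 3)` is a datum — the degree-35 identity `9Ψ₃²(Φ₃³ + AΦ₃Ψ₃⁴ + BΨ₃⁶) = P·W₃²`
(`[3]^*ω = 3ω`), checked by `ring`. [folklore] -/
theorem mulDatum_three (A B : ℚ) : MulDatum A B 3 := by
  simp only [MulDatum, WeierstrassCurve.Φ_three, WeierstrassCurve.ΨSq_three, WeierstrassCurve.Ψ₃,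
    WeierstrassCurve.preΨ₄, WeierstrassCurve.Ψ₂Sq,
    WeierstrassCurve.b₂, WeierstrassCurve.b₄, WeierstrassCurve.b₆, WeierstrassCurve.b₈]
  refine Polynomial.funext fun t => ?_
  simp only [map_sub, map_add, map_mul, derivative_mul, derivative_X_pow, derivative_C, derivative_X,
    derivative_pow, eval_sub, eval_add, eval_mul, eval_pow, eval_C, eval_X, eval_natCast, eval_ofNat,
    map_natCast]
  norm_num
  ring1

/-! ## 3. The engine: the Nash `m`-th root of the covering -/

/-- The unbounded ("identity") component `U = (e_max, ∞)` of `{P > 0}`, quantifier form. [folklore] -/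
def unb (A B : ℝ) : Set ℝ := {X | ∀ Y : ℝ, X ≤ Y → 0 < Y ^ 3 + A * Y + B}

/-- The x-rational isogeny datum, verbatim from the crux. [folklore] -/
def IsDatum (A B A' B' : ℤ) (f g : ℚ[X]) (c : ℚ) : Prop :=
  derivative f * g - f * derivative g ≠ 0 ∧
  C (c ^ 2) * g * (f ^ 3 + C (A' : ℚ) * f * g ^ 2 + C (B' : ℚ) * g ^ 3) =
    (X ^ 3 + C (A : ℚ) * X + C (B : ℚ)) * (derivative f * g - f * derivative g) ^ 2

/-- **Engine `NashRoot`** (card nash-root). For a coprime datum `(f, g, c) : (A,B) → (A′,B′)` and every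
connected component `C` of `{P > 0}` there are a positive integer `m` (the real degree of the datum
on `C` = its number of sheets) and a `ℚ`-semialgebraic strictly increasing `C¹` bijection
`χ : C → U′` onto the unbounded component of `{P′ > 0}` with `χ′(x)/√P′(χ x) = (|c|/m)/√P(x)` —
so that ONE instance of rule 2) carries `[C, a/√P]` to `[U′, (m·a/|c|)/√P′]`. Construction:
`graph χ` = the increasing branch of the real algebraic curve
`{(x, X) ∈ C × U′ : x∘[2m]′(X) = x∘[2]′(R x)}` (division polynomials of `(A′, B′)`; slope by
`slope_identity` and `MulDatum`); conceptually `χ = [2m]′⁻¹ ∘ [2]′ ∘ φ` on real identity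
components, the Nash group isomorphism `E(ℝ)⁰ ≅ E′(ℝ)⁰` of Madden–Stanton. Applied to the identity
datum `(X, 1, 1)` of `(A′, B′)` it yields `χ = id` on `U′` and the 2-torsion swap `egg′ → U′`.
[cite: KontsevichZagier2001, §1.2 rule (2)] -/
def NashRoot : Prop :=
  ∀ (A B A' B' : ℤ), 4 * A ^ 3 + 27 * B ^ 2 ≠ 0 → 4 * A' ^ 3 + 27 * B' ^ 2 ≠ 0 →
    ∀ (f g : ℚ[X]) (c : ℚ), IsCoprime f g → IsDatum A B A' B' f g c →
    ∀ x₀ : ℝ, 0 < x₀ ^ 3 + (A : ℝ) * x₀ + (B : ℝ) →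
    ∃ (m : ℕ) (χ χ' : ℝ → ℝ), 0 < m ∧
      IsSemialgebraicFunOn ℚ
        {p : Fin 1 → ℝ | p 0 ∈ connectedComponentIn {x : ℝ | 0 < x ^ 3 + (A : ℝ) * x + (B : ℝ)} x₀}
        (fun p => χ (p 0)) ∧
      StrictMonoOn χ (connectedComponentIn {x : ℝ | 0 < x ^ 3 + (A : ℝ) * x + (B : ℝ)} x₀) ∧
      χ '' connectedComponentIn {x : ℝ | 0 < x ^ 3 + (A : ℝ) * x + (B : ℝ)} x₀ = unb (A' : ℝ) (B' : ℝ) ∧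
      (∀ x ∈ connectedComponentIn {x : ℝ | 0 < x ^ 3 + (A : ℝ) * x + (B : ℝ)} x₀, HasDerivAt χ (χ' x) x) ∧
      ∀ x ∈ connectedComponentIn {x : ℝ | 0 < x ^ 3 + (A : ℝ) * x + (B : ℝ)} x₀,
        χ' x / Real.sqrt (χ x ^ 3 + (A' : ℝ) * χ x + (B' : ℝ)) =
          (|(c : ℝ)| / m) / Real.sqrt (x ^ 3 + (A : ℝ) * x + (B : ℝ))

/-- Shape of the line: the engine, the positivity of `∫_{U′} dX/√P′` (Disproof.lean `period_pos`) and
KZ bookkeeping (≤ 2 domain splits, ≤ 4 rule-2 moves along the `χ`'s, ≤ 2 merges on the literal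
domain `U′`, one scalar comparison) give the crux. Recorded as a `Prop` only (no skeleton at the
ideation stage). [folklore] -/
def NashReduction : Prop :=
  NashRoot → Summit.KontsevichZagierPeriods.KontsevichZagierPeriods.Theses.IsogenyCertificates.XMapPeriodTransfer

end Summit.KontsevichZagierPeriods.Cruxes.XMapPeriodTransfer.Ideator1G2
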